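import Summits.CriticalPhenomena.PercolationContinuityZ3.Theorems.SahiBoxTP2Conditioning
import Summits.CriticalPhenomena.PercolationContinuityZ3.Theorems.SahiIsingCumulations
import Summits.CriticalPhenomena.PercolationContinuityZ3.Theorems.SahiIsingGibbsStates

/-!
# The infinite-volume Ising states are monotonic: window patterns in the strong order give stochastically
# ordered conditional states (density-free Holley / Grimmett monotonicity on `{−1,+1}^ι`)

Support file of the Sahi cell (`prim-sahi`, typer seat, generation 15; `--supports stmt-CriticalPhenomena-4575`).
Theorems only (no definitions, no named facts, no sorries).  Companion of `SahiBoxTP2Conditioning.lean` (the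
engine `IsBoxTP2.cond_Icc_mono`: for a box-TP₂ law on a distributive measurable lattice in which box-TP₂
probability measures are positively associated, boxes in the strong set order are stochastically ordered).

On `{−1,+1}^ι` (`ι` countably infinite) the cylinder `{σ | σ_J = η}` of a window pattern `η ∈ {−1,+1}^J` is the
closed box between the `−`- and the `+`-padding of `η` (`restrict_preimage_singleton_eq_Icc`, generation 13), rays
`{≥ a}`, `{≤ b}` are boxes (`Ici_eq_Icc_spinConfig`), and box-TP₂ probability measures are positively associated
(`IsBoxTP2.isPositivelyAssociated_spinConfig`, generation 14).  Hence:

* `IsBoxTP2.cond_Icc_mono_spinConfig` / `setIntegral_Icc_mono_spinConfig` — boxes in the strong set order are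
  stochastically ordered under any finite box-TP₂ measure on `{−1,+1}^ι`;
* `IsBoxTP2.cond_cylinder_mono` — **for window patterns `η ≤ η'` and every measurable increasing event `U`
  (local or not), `μ(U ∩ {σ_J = η}) μ{σ_J = η'} ≤ μ{σ_J = η} μ(U ∩ {σ_J = η'})`**, i.e.
  `μ(U | σ_J = η) ≤ μ(U | σ_J = η')` when both patterns have positive mass (`IsBoxTP2.condReal_cylinder_mono`);
  `IsBoxTP2.setIntegral_cylinder_mono` — `E[f | σ_J = η] ≤ E[f | σ_J = η']` for bounded measurable increasing `f`;
* `IsBoxTP2.restrict_cylinder`, `IsBoxTP2.isPositivelyAssociated_cond_cylinder` — the law conditioned on a window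
  pattern is again box-TP₂, hence positively associated (strong positive association, density-free);
* THE ISING STATES ON `ℤ^d` (`d ≥ 1`, `β ≥ 0`; plus/minus state: any `h`; free state: `h ≥ 0`), box-TP₂ by
  generation 13's `isBoxTP2_of_forall_spinCorr_eq_plusCorr/minusCorr/freeCorr`:
  `plusState_cond_cylinder_mono`, `plusState_condexp_cylinder_mono`, `minusState_…`, `freeState_…` —
  **conditioning the infinite-volume state on a larger spin pattern in a finite window stochastically increases
  it, for ALL measurable increasing observables of the infinite configuration**, and the conditioned state is
  positively associated (`plusState_isPositivelyAssociated_cond_cylinder`).  For FINITE volumes with strictly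
  positive weights this is Grimmett's Thm. 2.24 (tree `HolleyCriterion.isMonotonic_of_isLogSupermodular`); the
  infinite-volume, measure-level statement is the cell's.

No sorries, no new axioms.
-/

noncomputable section

namespace Summit.CriticalPhenomena.PercolationContinuityZ3.Theorems.SahiBoxTP2

open MeasureTheory ProbabilityTheory Set Filter Topology Function
open Literature.Probability.LatticeModels Literature.Probability.Percolation
open scoped ENNReal

/-! ### Spin configurations `{−1,+1}^ι` -/

section Spins

variable {ι : Type*}

/-- On `{−1,+1}^ι` the ray `{σ ≥ a}` is the box `[a, +]`. [folklore] -/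
theorem Ici_eq_Icc_spinConfig (a : ι → ℤˣ) : Ici a = Icc a (fun _ => 1) :=
  Set.ext fun _ => ⟨fun h => ⟨h, fun _ => intUnits_le_one _⟩, fun h => h.1⟩

/-- On `{−1,+1}^ι` the ray `{σ ≤ b}` is the box `[−, b]`. [folklore] -/
theorem Iic_eq_Icc_spinConfig (b : ι → ℤˣ) : Iic b = Icc (fun _ => -1) b :=
  Set.ext fun _ => ⟨fun h => ⟨fun _ => neg_one_le_intUnits _, h⟩, fun h => h.2⟩

variable [Countable ι]

/-- Rays of `{−1,+1}^ι` (`ι` countable) are measurable. [folklore] -/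
theorem measurableSet_Ici_spinConfig (a : ι → ℤˣ) : MeasurableSet (Ici a) := by
  rw [Ici_eq_Icc_spinConfig]; exact measurableSet_Icc_spinConfig _ _

/-- Rays of `{−1,+1}^ι` (`ι` countable) are measurable. [folklore] -/
theorem measurableSet_Iic_spinConfig (b : ι → ℤˣ) : MeasurableSet (Iic b) := by
  rw [Iic_eq_Icc_spinConfig]; exact measurableSet_Icc_spinConfig _ _

/-- **The law conditioned on a window pattern is box-TP₂.** [this work] -/
theorem IsBoxTP2.restrict_cylinder (μ : Measure (ι → ℤˣ)) (hμ : IsBoxTP2 μ) (J : Finset ι) (η : ↥J → ℤˣ) :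
    IsBoxTP2 (μ.restrict ((fun σ : ι → ℤˣ => J.restrict σ) ⁻¹' {η})) := by
  rw [restrict_preimage_singleton_eq_Icc]
  exact hμ.restrict_Icc' measurableSet_Icc_spinConfig _ _

variable [Infinite ι]

/-- **`{−1,+1}^ι`: boxes in the strong set order are stochastically ordered under a box-TP₂ law** (`ι`
countably infinite): `μ(U ∩ [a₁,b₁]) μ[a₂,b₂] ≤ μ[a₁,b₁] μ(U ∩ [a₂,b₂])` for `a₁ ≤ a₂`, `b₁ ≤ b₂` and every
measurable increasing `U`. [this work] -/
theorem IsBoxTP2.cond_Icc_mono_spinConfig (μ : Measure (ι → ℤˣ)) [IsFiniteMeasure μ] (hμ : IsBoxTP2 μ)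
    {a₁ b₁ a₂ b₂ : ι → ℤˣ} (ha : a₁ ≤ a₂) (hb : b₁ ≤ b₂) {U : Set (ι → ℤˣ)} (hU : IsUpperSet U)
    (hUm : MeasurableSet U) : μ (U ∩ Icc a₁ b₁) * μ (Icc a₂ b₂) ≤ μ (Icc a₁ b₁) * μ (U ∩ Icc a₂ b₂) :=
  hμ.cond_Icc_mono measurableSet_Icc_spinConfig measurableSet_Ici_spinConfig measurableSet_Iic_spinConfig
    (fun ν _ hν => hν.isPositivelyAssociated_spinConfig ν) ha hb hU hUm

/-- `{−1,+1}^ι`, function form: `(∫_{[a₁,b₁]} f dμ) μ[a₂,b₂] ≤ μ[a₁,b₁] ∫_{[a₂,b₂]} f dμ` for bounded measurable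
increasing `f`. [this work] -/
theorem IsBoxTP2.setIntegral_Icc_mono_spinConfig (μ : Measure (ι → ℤˣ)) [IsFiniteMeasure μ] (hμ : IsBoxTP2 μ)
    {a₁ b₁ a₂ b₂ : ι → ℤˣ} (ha : a₁ ≤ a₂) (hb : b₁ ≤ b₂) {f : (ι → ℤˣ) → ℝ} (hf : Monotone f)
    (hfm : Measurable f) {C : ℝ} (hfC : ∀ x, |f x| ≤ C) :
    (∫ x in Icc a₁ b₁, f x ∂μ) * μ.real (Icc a₂ b₂) ≤ μ.real (Icc a₁ b₁) * ∫ x in Icc a₂ b₂, f x ∂μ :=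
  hμ.setIntegral_Icc_mono measurableSet_Icc_spinConfig measurableSet_Ici_spinConfig measurableSet_Iic_spinConfig
    (fun ν _ hν => hν.isPositivelyAssociated_spinConfig ν) ha hb hf hfm hfC

/-- **Window patterns in the strong order give stochastically ordered conditional laws**: for a finite box-TP₂
measure `μ` on `{−1,+1}^ι`, a finite window `J`, patterns `η ≤ η'` on `J` and every measurable increasing event
`U` of the infinite configuration, `μ(U ∩ {σ_J = η}) μ{σ_J = η'} ≤ μ{σ_J = η} μ(U ∩ {σ_J = η'})`. [this work] -/
theorem IsBoxTP2.cond_cylinder_mono (μ : Measure (ι → ℤˣ)) [IsFiniteMeasure μ] (hμ : IsBoxTP2 μ)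
    (J : Finset ι) {η η' : ↥J → ℤˣ} (hη : η ≤ η') {U : Set (ι → ℤˣ)} (hU : IsUpperSet U)
    (hUm : MeasurableSet U) :
    μ (U ∩ (fun σ : ι → ℤˣ => J.restrict σ) ⁻¹' {η}) * μ ((fun σ : ι → ℤˣ => J.restrict σ) ⁻¹' {η'}) ≤
      μ ((fun σ : ι → ℤˣ => J.restrict σ) ⁻¹' {η}) * μ (U ∩ (fun σ : ι → ℤˣ => J.restrict σ) ⁻¹' {η'}) := by
  classical
  rw [restrict_preimage_singleton_eq_Icc, restrict_preimage_singleton_eq_Icc]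
  exact hμ.cond_Icc_mono_spinConfig μ (glue_monotone J .minus hη) (glue_monotone J .plus hη) hU hUm

/-- **Conditional probabilities**: with both patterns of positive mass,
`μ(U | σ_J = η) ≤ μ(U | σ_J = η')` for `η ≤ η'` and every measurable increasing `U`. [this work] -/
theorem IsBoxTP2.condReal_cylinder_mono (μ : Measure (ι → ℤˣ)) [IsFiniteMeasure μ] (hμ : IsBoxTP2 μ)
    (J : Finset ι) {η η' : ↥J → ℤˣ} (hη : η ≤ η') (h0 : μ ((fun σ : ι → ℤˣ => J.restrict σ) ⁻¹' {η}) ≠ 0)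
    (h0' : μ ((fun σ : ι → ℤˣ => J.restrict σ) ⁻¹' {η'}) ≠ 0) {U : Set (ι → ℤˣ)} (hU : IsUpperSet U)
    (hUm : MeasurableSet U) :
    μ.real (U ∩ (fun σ : ι → ℤˣ => J.restrict σ) ⁻¹' {η}) / μ.real ((fun σ : ι → ℤˣ => J.restrict σ) ⁻¹' {η}) ≤
      μ.real (U ∩ (fun σ : ι → ℤˣ => J.restrict σ) ⁻¹' {η'}) /
        μ.real ((fun σ : ι → ℤˣ => J.restrict σ) ⁻¹' {η'}) := by
  have key := hμ.cond_cylinder_mono μ J hη hU hUm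
  have hpos : 0 < μ.real ((fun σ : ι → ℤˣ => J.restrict σ) ⁻¹' {η}) :=
    ENNReal.toReal_pos h0 (measure_ne_top _ _)
  have hpos' : 0 < μ.real ((fun σ : ι → ℤˣ => J.restrict σ) ⁻¹' {η'}) :=
    ENNReal.toReal_pos h0' (measure_ne_top _ _)
  rw [div_le_div_iff₀ hpos hpos']
  have := ENNReal.toReal_mono (ENNReal.mul_ne_top (measure_ne_top _ _) (measure_ne_top _ _)) key
  simpa only [ENNReal.toReal_mul, measureReal_def, mul_comm] using this

/-- **Conditional expectations**: `(∫_{σ_J = η} f dμ) μ{σ_J = η'} ≤ μ{σ_J = η} ∫_{σ_J = η'} f dμ` for `η ≤ η'` and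
every bounded measurable increasing `f`, i.e. `E[f | σ_J = η] ≤ E[f | σ_J = η']`. [this work] -/
theorem IsBoxTP2.setIntegral_cylinder_mono (μ : Measure (ι → ℤˣ)) [IsFiniteMeasure μ] (hμ : IsBoxTP2 μ)
    (J : Finset ι) {η η' : ↥J → ℤˣ} (hη : η ≤ η') {f : (ι → ℤˣ) → ℝ} (hf : Monotone f) (hfm : Measurable f)
    {C : ℝ} (hfC : ∀ x, |f x| ≤ C) :
    (∫ x in (fun σ : ι → ℤˣ => J.restrict σ) ⁻¹' {η}, f x ∂μ) * μ.real ((fun σ : ι → ℤˣ => J.restrict σ) ⁻¹' {η'})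
      ≤ μ.real ((fun σ : ι → ℤˣ => J.restrict σ) ⁻¹' {η}) *
        ∫ x in (fun σ : ι → ℤˣ => J.restrict σ) ⁻¹' {η'}, f x ∂μ := by
  classical
  rw [restrict_preimage_singleton_eq_Icc, restrict_preimage_singleton_eq_Icc]
  exact hμ.setIntegral_Icc_mono_spinConfig μ (glue_monotone J .minus hη) (glue_monotone J .plus hη) hf hfm hfC

/-- **Strong positive association, density-free**: the law of a box-TP₂ measure conditioned on a window pattern
of positive (finite) mass is positively associated. [this work] -/
theorem IsBoxTP2.isPositivelyAssociated_cond_cylinder (μ : Measure (ι → ℤˣ)) (hμ : IsBoxTP2 μ) (J : Finset ι)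
    (η : ↥J → ℤˣ) (h0 : μ ((fun σ : ι → ℤˣ => J.restrict σ) ⁻¹' {η}) ≠ 0)
    (ht : μ ((fun σ : ι → ℤˣ => J.restrict σ) ⁻¹' {η}) ≠ ∞) :
    IsPositivelyAssociated ((μ ((fun σ : ι → ℤˣ => J.restrict σ) ⁻¹' {η}))⁻¹ •
      μ.restrict ((fun σ : ι → ℤˣ => J.restrict σ) ⁻¹' {η})) := by
  rw [restrict_preimage_singleton_eq_Icc] at h0 ht ⊢
  exact hμ.isPositivelyAssociated_cond_Icc measurableSet_Icc_spinConfig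
    (fun ν _ hν => hν.isPositivelyAssociated_spinConfig ν) h0 ht

end Spins

/-! ### The Ising states on `ℤ^d` -/

section Ising

variable {d : ℕ} [NeZero d] {β h : ℝ}

/-- **THE PLUS STATE IS MONOTONIC** (`d ≥ 1`, `β ≥ 0`, any `h`): for every probability measure on `{−1,+1}^{ℤ^d}`
with the plus correlations (the plus state `μ⁺_{β,h}`), a finite window `J`, patterns `η ≤ η'` on `J` and every
measurable increasing event `U` of the infinite configuration:
`μ⁺(U ∩ {σ_J = η}) μ⁺{σ_J = η'} ≤ μ⁺{σ_J = η} μ⁺(U ∩ {σ_J = η'})`. [this work] -/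
theorem plusState_cond_cylinder_mono (hβ : 0 ≤ β) (μ : Measure (SpinConfig (Site d))) [IsProbabilityMeasure μ]
    (hμ : ∀ B : Finset (Site d), spinCorr μ B = plusCorr d β h B) (J : Finset (Site d))
    {η η' : ↥J → ℤˣ} (hη : η ≤ η') {U : Set (SpinConfig (Site d))} (hU : IsUpperSet U) (hUm : MeasurableSet U) :
    μ (U ∩ (fun σ : SpinConfig (Site d) => J.restrict σ) ⁻¹' {η}) *
        μ ((fun σ : SpinConfig (Site d) => J.restrict σ) ⁻¹' {η'}) ≤
      μ ((fun σ : SpinConfig (Site d) => J.restrict σ) ⁻¹' {η}) *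
        μ (U ∩ (fun σ : SpinConfig (Site d) => J.restrict σ) ⁻¹' {η'}) := by
  haveI : Infinite (Site d) := infinite_site_of_neZero
  exact IsBoxTP2.cond_cylinder_mono μ (isBoxTP2_of_forall_spinCorr_eq_plusCorr hβ μ hμ) J hη hU hUm

/-- **Plus state, conditional expectations**: `E⁺[f | σ_J = η] ≤ E⁺[f | σ_J = η']` (unnormalised form) for
`η ≤ η'` and every bounded measurable increasing `f`. [this work] -/
theorem plusState_condexp_cylinder_mono (hβ : 0 ≤ β) (μ : Measure (SpinConfig (Site d)))
    [IsProbabilityMeasure μ] (hμ : ∀ B : Finset (Site d), spinCorr μ B = plusCorr d β h B) (J : Finset (Site d))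
    {η η' : ↥J → ℤˣ} (hη : η ≤ η') {f : SpinConfig (Site d) → ℝ} (hf : Monotone f) (hfm : Measurable f)
    {C : ℝ} (hfC : ∀ x, |f x| ≤ C) :
    (∫ x in (fun σ : SpinConfig (Site d) => J.restrict σ) ⁻¹' {η}, f x ∂μ) *
        μ.real ((fun σ : SpinConfig (Site d) => J.restrict σ) ⁻¹' {η'}) ≤
      μ.real ((fun σ : SpinConfig (Site d) => J.restrict σ) ⁻¹' {η}) *
        ∫ x in (fun σ : SpinConfig (Site d) => J.restrict σ) ⁻¹' {η'}, f x ∂μ := by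
  haveI : Infinite (Site d) := infinite_site_of_neZero
  exact IsBoxTP2.setIntegral_cylinder_mono μ (isBoxTP2_of_forall_spinCorr_eq_plusCorr hβ μ hμ) J hη hf hfm hfC

/-- **Plus state: the state conditioned on a window pattern of positive mass is positively associated**
(strong positive association in infinite volume). [this work] -/
theorem plusState_isPositivelyAssociated_cond_cylinder (hβ : 0 ≤ β) (μ : Measure (SpinConfig (Site d)))
    [IsProbabilityMeasure μ] (hμ : ∀ B : Finset (Site d), spinCorr μ B = plusCorr d β h B) (J : Finset (Site d))
    (η : ↥J → ℤˣ) (h0 : μ ((fun σ : SpinConfig (Site d) => J.restrict σ) ⁻¹' {η}) ≠ 0) :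
    IsPositivelyAssociated ((μ ((fun σ : SpinConfig (Site d) => J.restrict σ) ⁻¹' {η}))⁻¹ •
      μ.restrict ((fun σ : SpinConfig (Site d) => J.restrict σ) ⁻¹' {η})) := by
  haveI : Infinite (Site d) := infinite_site_of_neZero
  exact IsBoxTP2.isPositivelyAssociated_cond_cylinder μ (isBoxTP2_of_forall_spinCorr_eq_plusCorr hβ μ hμ) J η h0
    (measure_ne_top _ _)

/-- **THE MINUS STATE IS MONOTONIC** (`d ≥ 1`, `β ≥ 0`, any `h`). [this work] -/
theorem minusState_cond_cylinder_mono (hβ : 0 ≤ β) (μ : Measure (SpinConfig (Site d))) [IsProbabilityMeasure μ]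
    (hμ : ∀ B : Finset (Site d), spinCorr μ B = minusCorr d β h B) (J : Finset (Site d))
    {η η' : ↥J → ℤˣ} (hη : η ≤ η') {U : Set (SpinConfig (Site d))} (hU : IsUpperSet U) (hUm : MeasurableSet U) :
    μ (U ∩ (fun σ : SpinConfig (Site d) => J.restrict σ) ⁻¹' {η}) *
        μ ((fun σ : SpinConfig (Site d) => J.restrict σ) ⁻¹' {η'}) ≤
      μ ((fun σ : SpinConfig (Site d) => J.restrict σ) ⁻¹' {η}) *
        μ (U ∩ (fun σ : SpinConfig (Site d) => J.restrict σ) ⁻¹' {η'}) := by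
  haveI : Infinite (Site d) := infinite_site_of_neZero
  exact IsBoxTP2.cond_cylinder_mono μ (isBoxTP2_of_forall_spinCorr_eq_minusCorr hβ μ hμ) J hη hU hUm

/-- Minus state, conditional expectations. [this work] -/
theorem minusState_condexp_cylinder_mono (hβ : 0 ≤ β) (μ : Measure (SpinConfig (Site d)))
    [IsProbabilityMeasure μ] (hμ : ∀ B : Finset (Site d), spinCorr μ B = minusCorr d β h B) (J : Finset (Site d))
    {η η' : ↥J → ℤˣ} (hη : η ≤ η') {f : SpinConfig (Site d) → ℝ} (hf : Monotone f) (hfm : Measurable f)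
    {C : ℝ} (hfC : ∀ x, |f x| ≤ C) :
    (∫ x in (fun σ : SpinConfig (Site d) => J.restrict σ) ⁻¹' {η}, f x ∂μ) *
        μ.real ((fun σ : SpinConfig (Site d) => J.restrict σ) ⁻¹' {η'}) ≤
      μ.real ((fun σ : SpinConfig (Site d) => J.restrict σ) ⁻¹' {η}) *
        ∫ x in (fun σ : SpinConfig (Site d) => J.restrict σ) ⁻¹' {η'}, f x ∂μ := by
  haveI : Infinite (Site d) := infinite_site_of_neZero
  exact IsBoxTP2.setIntegral_cylinder_mono μ (isBoxTP2_of_forall_spinCorr_eq_minusCorr hβ μ hμ) J hη hf hfm hfC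

/-- **THE FREE STATE IS MONOTONIC** (`d ≥ 1`, `β ≥ 0`, `h ≥ 0`). [this work] -/
theorem freeState_cond_cylinder_mono (hβ : 0 ≤ β) (hh : 0 ≤ h) (μ : Measure (SpinConfig (Site d)))
    [IsProbabilityMeasure μ] (hμ : ∀ B : Finset (Site d), spinCorr μ B = freeCorr d β h B) (J : Finset (Site d))
    {η η' : ↥J → ℤˣ} (hη : η ≤ η') {U : Set (SpinConfig (Site d))} (hU : IsUpperSet U) (hUm : MeasurableSet U) :
    μ (U ∩ (fun σ : SpinConfig (Site d) => J.restrict σ) ⁻¹' {η}) *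
        μ ((fun σ : SpinConfig (Site d) => J.restrict σ) ⁻¹' {η'}) ≤
      μ ((fun σ : SpinConfig (Site d) => J.restrict σ) ⁻¹' {η}) *
        μ (U ∩ (fun σ : SpinConfig (Site d) => J.restrict σ) ⁻¹' {η'}) := by
  haveI : Infinite (Site d) := infinite_site_of_neZero
  exact IsBoxTP2.cond_cylinder_mono μ (isBoxTP2_of_forall_spinCorr_eq_freeCorr hβ hh μ hμ) J hη hU hUm

/-- Free state, conditional expectations (`h ≥ 0`). [this work] -/
theorem freeState_condexp_cylinder_mono (hβ : 0 ≤ β) (hh : 0 ≤ h) (μ : Measure (SpinConfig (Site d)))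
    [IsProbabilityMeasure μ] (hμ : ∀ B : Finset (Site d), spinCorr μ B = freeCorr d β h B) (J : Finset (Site d))
    {η η' : ↥J → ℤˣ} (hη : η ≤ η') {f : SpinConfig (Site d) → ℝ} (hf : Monotone f) (hfm : Measurable f)
    {C : ℝ} (hfC : ∀ x, |f x| ≤ C) :
    (∫ x in (fun σ : SpinConfig (Site d) => J.restrict σ) ⁻¹' {η}, f x ∂μ) *
        μ.real ((fun σ : SpinConfig (Site d) => J.restrict σ) ⁻¹' {η'}) ≤
      μ.real ((fun σ : SpinConfig (Site d) => J.restrict σ) ⁻¹' {η}) *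
        ∫ x in (fun σ : SpinConfig (Site d) => J.restrict σ) ⁻¹' {η'}, f x ∂μ := by
  haveI : Infinite (Site d) := infinite_site_of_neZero
  exact IsBoxTP2.setIntegral_cylinder_mono μ (isBoxTP2_of_forall_spinCorr_eq_freeCorr hβ hh μ hμ) J hη hf hfm
    hfC

end Ising

end Summit.CriticalPhenomena.PercolationContinuityZ3.Theorems.SahiBoxTP2
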